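import Mathlib
import Summits.ValiantsHypothesis.ValiantsHypothesis.Theorems.DivisionGapPerMultiplesHardSpreadPatterns
import Summits.ValiantsHypothesis.ValiantsHypothesis.Theorems.DivisionGapPerMultiplesHardThinPatterns
import Literature.Computability.AlgebraicComplexity.ArithCircuitProofs
import Literature.Computability.AlgebraicComplexity.PermanentIrreducible

/-!
# The complete-class rung, counting half (line `uncharged-face-walk` of crux `PerMultiplesHard`,
route DivisionGap; stub `stub_completeClassRung`)

Let `ζ = finRotate n` be the row shift of the `n × n` board.  A `ζ`-SPREAD PROBE for a permutation
`π` is an exponent table `M` all of whose cells `(a, b)` satisfy `π b = a ∨ π b = ζ a`.  If the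
cofactor `t ∈ ℝ≥0[x_ij]` is torus-homogeneous (margins `(R, C)`) and carries a `ζ`-spread probe for
EVERY permutation `π`, then so does `g := per_n · t` (the monomial `μ_π + M` of `per_n · t` — supports
add over `ℝ≥0` — is again a probe for `π`, because the cells of `μ_π` are the cells `(π b, b)`), and
`g` is torus-homogeneous with margins `(R + 1, C + 1)`, all rows hit.  The spread engine
(`SpreadPatterns.spreadPatterns`) then reads `n! · 5^{⌊n/10⌋} ≤ L(per_n · t) · 4^{⌊n/10⌋} · n!`, and
cancelling `n!` gives the rung `5^{⌊n/10⌋} ≤ L(per_n · t) · 4^{⌊n/10⌋}` (`stub_completeClassRung`).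

Not here: the construction of the probes (`TwoBandTable.stub_twoBandTable`) and the line's open core.
-/

noncomputable section

-- the namespace `Summit.ValiantsHypothesis.ValiantsHypothesis.…` is mandated by the crux (registered stub names)
set_option linter.dupNamespace false

namespace Summit.ValiantsHypothesis.ValiantsHypothesis.Theorems.DivisionGap.PerMultiplesHard.CompleteClassRung

open MvPolynomial Literature.Computability.AlgebraicComplexity
open scoped NNReal BigOperators

/-- Every permutation monomial `μ_π` lies in the support of the permanent (its coefficient is `1`).
[folklore] -/
theorem permMonomial_mem_support_perPoly {n : ℕ} (π : Equiv.Perm (Fin n)) :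
    permMonomial π ∈ (perPoly (Fin n) ℝ≥0).support := by
  rw [MvPolynomial.mem_support_iff, coeff_permMonomial_perPoly]
  exact one_ne_zero

/-- **Probes lift through `per_n`.**  If `M ∈ supp t` is a `ζ`-spread probe for `π`, then
`μ_π + M ∈ supp (per_n · t)` (no cancellation over `ℝ≥0`) is a `ζ`-spread probe for `π`: a cell of
`μ_π` is `(π b, b)`, and a cell of `M` is a probe cell by hypothesis. [folklore] -/
theorem probe_perPoly_mul {n : ℕ} {ζ : Equiv.Perm (Fin n)} {t : MvPolynomial (Fin n × Fin n) ℝ≥0}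
    (π : Equiv.Perm (Fin n)) {M : (Fin n × Fin n) →₀ ℕ} (hM : M ∈ t.support)
    (hprobe : ∀ e ∈ M.support, π e.2 = e.1 ∨ π e.2 = ζ e.1) :
    ∃ m ∈ (perPoly (Fin n) ℝ≥0 * t).support, ∀ e ∈ m.support, π e.2 = e.1 ∨ π e.2 = ζ e.1 := by
  classical
  refine ⟨permMonomial π + M,
    ThinPatterns.add_mem_support_mul (permMonomial_mem_support_perPoly π) hM, ?_⟩
  rintro ⟨r, c⟩ he
  rcases Finset.mem_union.mp (Finsupp.support_add he) with h | h
  · left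
    have h' := Finsupp.mem_support_iff.mp h
    rw [permMonomial_apply] at h'
    by_contra hne
    exact h' (if_neg hne)
  · exact hprobe _ h

/-- **The complete-class rung, counting half** (registered stub `stub_completeClassRung`).  For
`n ≥ 5` and a torus-homogeneous cofactor `t ∈ ℝ≥0[x_ij]` (margins `(R, C)`) carrying a
`finRotate`-spread probe for every permutation `π`, one has `5^{⌊n/10⌋} ≤ L(per_n · t) · 4^{⌊n/10⌋}`.
Proof: `per_n · t` is torus-homogeneous with margins `(R + 1, C + 1)` (`ThinPatterns.margins_perPoly_mul`),
all rows hit; every `π` has the probe `μ_π + M` in `supp (per_n · t)` (`probe_perPoly_mul`), so the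
filter of probed permutations is all of `S_n` and the spread engine (`SpreadPatterns.spreadPatterns`,
shift `finRotate n`) gives `n! · 5^{⌊n/10⌋} ≤ L(per_n · t) · 4^{⌊n/10⌋} · n!`; cancel `n! > 0`.
[cite: JerrumSnir1982, §3–4] -/
theorem stub_completeClassRung :
    ∀ n ≥ 5, ∀ (t : MvPolynomial (Fin n × Fin n) ℝ≥0) (R C : Fin n → ℕ),
      (∀ m ∈ t.support, (∀ i, ∑ j, m (i, j) = R i) ∧ (∀ j, ∑ i, m (i, j) = C j)) →
      (∀ π : Equiv.Perm (Fin n), ∃ M ∈ t.support, ∀ e ∈ M.support, π e.2 = e.1 ∨ π e.2 = finRotate n e.1) →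
      5 ^ (n / 10) ≤ complexity (perPoly (Fin n) ℝ≥0 * t) * 4 ^ (n / 10) := by
  classical
  intro n hn t R C ht hprobe
  have hmarg := ThinPatterns.margins_perPoly_mul ht
  have hsp := SpreadPatterns.spreadPatterns n hn (finRotate n) (perPoly (Fin n) ℝ≥0 * t)
    (fun i => R i + 1) (fun j => C j + 1) hmarg (fun i => Nat.succ_ne_zero _)
  have hfilter : ((Finset.univ : Finset (Equiv.Perm (Fin n))).filter fun π =>
      ∃ m ∈ (perPoly (Fin n) ℝ≥0 * t).support, ∀ e ∈ m.support,
        π e.2 = e.1 ∨ π e.2 = finRotate n e.1) = Finset.univ := by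
    refine Finset.filter_true_of_mem fun π _ => ?_
    obtain ⟨M, hM, hMp⟩ := hprobe π
    exact probe_perPoly_mul π hM hMp
  rw [hfilter, Finset.card_univ, Fintype.card_perm, Fintype.card_fin] at hsp
  -- `hsp : n! * 5^{⌊n/10⌋} ≤ L(per · t) * (4^{⌊n/10⌋} * n!)`; cancel `n!`
  refine Nat.le_of_mul_le_mul_right (c := n.factorial) ?_ (Nat.factorial_pos n)
  calc 5 ^ (n / 10) * n.factorial = n.factorial * 5 ^ (n / 10) := mul_comm _ _
    _ ≤ complexity (perPoly (Fin n) ℝ≥0 * t) * (4 ^ (n / 10) * n.factorial) := hsp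
    _ = complexity (perPoly (Fin n) ℝ≥0 * t) * 4 ^ (n / 10) * n.factorial := (mul_assoc _ _ _).symm

end Summit.ValiantsHypothesis.ValiantsHypothesis.Theorems.DivisionGap.PerMultiplesHard.CompleteClassRung
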